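import Mathlib.Geometry.Manifold.Instances.Sphere
import Mathlib.Geometry.Manifold.LocalDiffeomorph
import Mathlib.Analysis.SpecialFunctions.Sqrt
import Mathlib.Analysis.InnerProductSpace.Calculus
import Literature.Topology.FourManifolds.InverseFunctionTheorem
import Summits.SmoothPoincare4.SmoothPoincare4.Theorems.SymplecticOrigamiOrigamiFoldExistenceShadowPleatsDefs

/-!
# Stub `stub_pleatFreeStandard` of line `shadow-pleats` for crux `OrigamiFoldExistence` — I: shadow geometry
(item stmt-SmoothPoincare4-7844, route route-SmoothPoincare4-SymplecticOrigami; line lead seat 1)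

First of four files proving the registered stub `stub_pleatFreeStandard` (PLEAT-FREE ⇒ STANDARD:
a homotopy `4`-sphere `M` with a `0`-pleat round-rim shadow position `HasPleatedPosition M 0` is
diffeomorphic to `S⁴`).  This file holds the proof-internal gadgets on `ℝ⁵ = ℝ⁴ × ℝ` (no new
mathematical objects; everything is elementary over Mathlib and the line vocabulary
`…Theorems.OrigamiFoldExistence.ShadowPleats.proj5`):

* `heightL` (the height coordinate `p 4` as a CLM), `embedL` (the horizontal embedding
  `x ↦ (x, 0)`), `e4` (the vertical unit vector), Pythagoras `‖p‖² = ‖proj5 p‖² + (p 4)²`;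
* `polarLift x = (x, √(1 - ‖x‖²))` — the inverse shadow chart of the upper hemisphere: shadow
  identity, lands on the sphere over the closed unit ball, recovers a point of the closed upper
  hemisphere from its shadow, smooth on the open unit ball;
* `mem_closure_sphere_inter_lt` — a point of the sphere at height `c ∈ (-1, 1)` is a limit of
  sphere points of height `< c` (explicit meridian path);
* `isLocalDiffeomorphAt_of_injective_mfderiv_four` — the inverse function theorem for maps of
  `4`-manifolds modelled on `ℝ⁴` with injective differential (from the tree's
  `Literature.Topology.FourManifolds.isLocalDiffeomorphAt_of_mfderiv`, Lee 2013 Thm 4.5);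
* `straighten ι δ` — the STRAIGHTENING map of the final argument (`ι` on and below the plane
  `h = 1 - δ`, the polar lift of the shadow above it) and its definitional lemmas.

Sources: J. M. Lee, *Introduction to Smooth Manifolds* (2013), Thm 4.5 [LeeSmoothManifolds2013];
the planner's proof sketch in the skeleton docstring of `stub_pleatFreeStandard`
(Cruxes/OrigamiFoldExistence/Lines/shadow_pleats.lean).  Files II–IV: `…Seam`, `…Sheets`, and
`SymplecticOrigamiOrigamiFoldExistenceStubPleatFreeStandard.lean` (the stub itself).
-/

noncomputable section

-- the prescribed namespace `Summit.<P>.<Sub>.…` duplicates `SmoothPoincare4` (P = Sub)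
set_option linter.dupNamespace false

open scoped Manifold ContDiff Topology RealInnerProductSpace
open Set Function Filter Metric ContinuousMap

namespace Summit.SmoothPoincare4.SmoothPoincare4.Theorems.OrigamiFoldExistence.ShadowPleats

/-! ## Proof of `stub_pleatFreeStandard`

Throughout, `(EuclideanSpace ℝ (Fin 4)) = ℝ⁴ = ℂ²` is the shadow space, `(EuclideanSpace ℝ (Fin 5)) = ℝ⁵ = ℂ² × ℝ` the ambient space with height
coordinate `p 4`, and `(Metric.sphere (0 : EuclideanSpace ℝ (Fin 5)) 1) ⊂ (EuclideanSpace ℝ (Fin 5))` the round unit sphere with Mathlib's manifold structure. -/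

/-! ### Height, shadow, the horizontal embedding and the polar lift -/

/-- The HEIGHT coordinate `p ↦ p 4` as a continuous linear map. -/
def heightL : (EuclideanSpace ℝ (Fin 5)) →L[ℝ] ℝ := EuclideanSpace.proj (4 : Fin 5)

/-- `heightL p = p 4` by definition. -/
@[simp] theorem heightL_apply (p : (EuclideanSpace ℝ (Fin 5))) : heightL p = p 4 := rfl

/-- Pythagoras in `ℝ⁵ = ℝ⁴ × ℝ`: `‖p‖² = ‖proj5 p‖² + (p 4)²`. [folklore] -/
theorem norm_sq_eq_norm_proj5_sq_add_sq (p : (EuclideanSpace ℝ (Fin 5))) : ‖p‖ ^ 2 = ‖proj5 p‖ ^ 2 + (p 4) ^ 2 := by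
  simp only [EuclideanSpace.norm_sq_eq, Fin.sum_univ_five, Fin.sum_univ_four, proj5,
    Real.norm_eq_abs, sq_abs]
  simp

/-- On the unit sphere the shadow has `‖proj5 p‖² = 1 - (p 4)²`. [folklore] -/
theorem norm_proj5_sq_of_mem_sphere {p : (EuclideanSpace ℝ (Fin 5))} (hp : p ∈ (Metric.sphere (0 : EuclideanSpace ℝ (Fin 5)) 1)) : ‖proj5 p‖ ^ 2 = 1 - (p 4) ^ 2 := by
  have h1 : ‖p‖ = 1 := by simpa using hp
  have := norm_sq_eq_norm_proj5_sq_add_sq p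
  rw [h1, one_pow] at this
  linarith

/-- The HORIZONTAL EMBEDDING `ℝ⁴ → ℝ⁵`, `x ↦ (x, 0)`, as a continuous linear map. -/
def embedL : (EuclideanSpace ℝ (Fin 4)) →L[ℝ] (EuclideanSpace ℝ (Fin 5)) :=
  LinearMap.toContinuousLinearMap
    { toFun := fun x => WithLp.toLp 2 ![x 0, x 1, x 2, x 3, 0]
      map_add' := fun x y => by
        ext i
        fin_cases i <;> simp
      map_smul' := fun c x => by
        ext i
        fin_cases i <;> simp }

/-- The VERTICAL unit vector `∂_h = e₄` of `ℝ⁵`. -/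
def e4 : (EuclideanSpace ℝ (Fin 5)) := EuclideanSpace.single (4 : Fin 5) (1 : ℝ)

/-- Coordinates of `embedL x`. -/
theorem embedL_apply (x : (EuclideanSpace ℝ (Fin 4))) : embedL x = WithLp.toLp 2 ![x 0, x 1, x 2, x 3, 0] := rfl

/-- The shadow of the horizontal embedding is the identity. -/
@[simp] theorem proj5_embedL (x : (EuclideanSpace ℝ (Fin 4))) : proj5 (embedL x) = x := by
  ext i
  fin_cases i <;> simp [proj5, embedL_apply]

/-- The vertical vector has no shadow. -/
@[simp] theorem proj5_e4 : proj5 e4 = 0 := by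
  ext i
  fin_cases i <;> simp [proj5, e4]

/-- The horizontal embedding has height `0`. -/
@[simp] theorem embedL_apply_four (x : (EuclideanSpace ℝ (Fin 4))) : embedL x 4 = 0 := by simp [embedL_apply]

/-- The vertical unit vector has height `1`. -/
@[simp] theorem e4_apply_four : e4 4 = 1 := by simp [e4]

/-- The shadow is additive (it is the linear map `proj5L`). -/
theorem proj5_add (a b : (EuclideanSpace ℝ (Fin 5))) : proj5 (a + b) = proj5 a + proj5 b := by
  rw [← proj5L_apply, map_add, proj5L_apply, proj5L_apply]

/-- The shadow is homogeneous (it is the linear map `proj5L`). -/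
theorem proj5_smul (c : ℝ) (a : (EuclideanSpace ℝ (Fin 5))) : proj5 (c • a) = c • proj5 a := by
  rw [← proj5L_apply, map_smul, proj5L_apply]

/-- Every point of `ℝ⁵` is its shadow, embedded horizontally, plus its height times `e₄`. -/
theorem embedL_proj5_add_smul (p : (EuclideanSpace ℝ (Fin 5))) : embedL (proj5 p) + (p 4) • e4 = p := by
  ext i
  fin_cases i <;> simp [proj5, e4, embedL_apply]

/-- `‖embedL x + t • e₄‖² = ‖x‖² + t²`. -/
theorem norm_sq_embedL_add_smul (x : (EuclideanSpace ℝ (Fin 4))) (t : ℝ) : ‖embedL x + t • e4‖ ^ 2 = ‖x‖ ^ 2 + t ^ 2 := by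
  rw [norm_sq_eq_norm_proj5_sq_add_sq, proj5_add, proj5_smul, proj5_embedL, proj5_e4, smul_zero,
    add_zero]
  simp

/-- The POLAR LIFT `σ : ℝ⁴ → ℝ⁵`, `σ x = (x, √(1 - ‖x‖²))`: the inverse shadow chart of the open
upper hemisphere (meaningful for `‖x‖ ≤ 1`). -/
def polarLift (x : (EuclideanSpace ℝ (Fin 4))) : (EuclideanSpace ℝ (Fin 5)) := embedL x + Real.sqrt (1 - ‖x‖ ^ 2) • e4

/-- The shadow of the polar lift is the identity. -/
@[simp] theorem proj5_polarLift (x : (EuclideanSpace ℝ (Fin 4))) : proj5 (polarLift x) = x := by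
  rw [polarLift, proj5_add, proj5_smul, proj5_embedL, proj5_e4, smul_zero, add_zero]

/-- The height of the polar lift. -/
theorem polarLift_apply_four (x : (EuclideanSpace ℝ (Fin 4))) : polarLift x 4 = Real.sqrt (1 - ‖x‖ ^ 2) := by
  simp [polarLift]

/-- The polar lift is injective (its shadow is the identity). -/
theorem injective_polarLift : Injective polarLift := fun x y h => by
  simpa using congrArg proj5 h

/-- Over the closed unit ball the polar lift lands on the unit sphere. -/
theorem polarLift_mem_sphere {x : (EuclideanSpace ℝ (Fin 4))} (hx : ‖x‖ ≤ 1) : polarLift x ∈ (Metric.sphere (0 : EuclideanSpace ℝ (Fin 5)) 1) := by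
  have h0 : 0 ≤ 1 - ‖x‖ ^ 2 := by nlinarith [norm_nonneg x]
  have : ‖polarLift x‖ ^ 2 = 1 := by
    rw [polarLift, norm_sq_embedL_add_smul, Real.sq_sqrt h0]
    ring
  have h1 : ‖polarLift x‖ = 1 := by
    nlinarith [norm_nonneg (polarLift x)]
  simpa using h1

/-- A point of the closed upper unit hemisphere is the polar lift of its shadow. -/
theorem polarLift_proj5 {p : (EuclideanSpace ℝ (Fin 5))} (hp : p ∈ (Metric.sphere (0 : EuclideanSpace ℝ (Fin 5)) 1)) (h4 : 0 ≤ p 4) : polarLift (proj5 p) = p := by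
  have hsq : Real.sqrt (1 - ‖proj5 p‖ ^ 2) = p 4 := by
    rw [norm_proj5_sq_of_mem_sphere hp, sub_sub_cancel, Real.sqrt_sq h4]
  rw [polarLift, hsq, embedL_proj5_add_smul]

/-- The polar lift is smooth on the open unit ball. [folklore] -/
theorem contDiffAt_polarLift {x : (EuclideanSpace ℝ (Fin 4))} (hx : ‖x‖ < 1) : ContDiffAt ℝ ∞ polarLift x := by
  have h0 : 1 - ‖x‖ ^ 2 ≠ 0 := by nlinarith [norm_nonneg x]
  have h1 : ContDiffAt ℝ ∞ (fun y : (EuclideanSpace ℝ (Fin 4)) => 1 - ‖y‖ ^ 2) x :=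
    contDiffAt_const.sub (contDiff_norm_sq ℝ).contDiffAt
  exact embedL.contDiff.contDiffAt.add ((h1.sqrt h0).smul contDiffAt_const)

/-- A vector of `ℝ⁵` orthogonal to a point `p` of non-zero height and with zero shadow is zero
(`⟪p, w⟫ = p₄ w₄`). [folklore] -/
theorem eq_zero_of_inner_eq_zero_of_proj5_eq_zero {p w : (EuclideanSpace ℝ (Fin 5))} (hp : p 4 ≠ 0) (hinner : ⟪p, w⟫ = 0)
    (hw : proj5 w = 0) : w = 0 := by
  have hcoords := apply_eq_zero_of_proj5_eq_zero hw
  rw [PiLp.inner_apply, Fin.sum_univ_five] at hinner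
  simp [hcoords 0 (by decide), hcoords 1 (by decide), hcoords 2 (by decide),
    hcoords 3 (by decide), hp] at hinner
  ext i
  fin_cases i
  · simpa using hcoords 0 (by decide)
  · simpa using hcoords 1 (by decide)
  · simpa using hcoords 2 (by decide)
  · simpa using hcoords 3 (by decide)
  · simpa using hinner

/-! ### Approaching a point of the sphere from below -/

/-- A point `p` of the unit sphere at height `c ∈ (-1, 1)` is a limit of points of the sphere of
height `< c` (slide down the meridian through `p`). [folklore] -/
theorem mem_closure_sphere_inter_lt {p : EuclideanSpace ℝ (Fin 5)}
    (hp : p ∈ Metric.sphere (0 : EuclideanSpace ℝ (Fin 5)) 1) {c : ℝ} (hc : p 4 = c) (hc1 : c < 1)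
    (hcm : -1 < c) :
    p ∈ closure ((Metric.sphere (0 : EuclideanSpace ℝ (Fin 5)) 1 : Set (EuclideanSpace ℝ (Fin 5))) ∩
      {q : EuclideanSpace ℝ (Fin 5) | q 4 < c}) := by
  set x₀ : (EuclideanSpace ℝ (Fin 4)) := proj5 p with hx₀
  have hx₀sq : ‖x₀‖ ^ 2 = 1 - c ^ 2 := by rw [hx₀, norm_proj5_sq_of_mem_sphere hp, hc]
  have h1c : 0 < 1 - c ^ 2 := by nlinarith
  have hx₀pos : 0 < ‖x₀‖ := by
    have : 0 < ‖x₀‖ ^ 2 := by rw [hx₀sq]; exact h1c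
    nlinarith [norm_nonneg x₀]
  have hx₀norm : ‖x₀‖ = Real.sqrt (1 - c ^ 2) := by
    rw [← hx₀sq, Real.sqrt_sq (norm_nonneg _)]
  -- the meridian path
  set f : ℝ → (EuclideanSpace ℝ (Fin 5)) := fun t =>
    embedL ((Real.sqrt (1 - (c - t) ^ 2) / ‖x₀‖) • x₀) + (c - t) • e4 with hf
  have hf0 : f 0 = p := by
    simp only [hf, sub_zero]
    rw [← hx₀norm, div_self hx₀pos.ne', one_smul, hx₀, ← hc, embedL_proj5_add_smul]
  have hfcont : Continuous f := by
    simp only [hf]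
    fun_prop
  -- choose `ε > 0` with `c - t > -1` for `t < ε`
  obtain ⟨ε, hε, hεc⟩ : ∃ ε : ℝ, 0 < ε ∧ ∀ t, t < ε → -1 < c - t :=
    ⟨c + 1, by linarith, fun t ht => by linarith⟩
  have hmem : ∀ t ∈ Set.Ioo (0 : ℝ) ε, f t ∈ (Metric.sphere (0 : EuclideanSpace ℝ (Fin 5)) 1 : Set (EuclideanSpace ℝ (Fin 5))) ∩ {q : (EuclideanSpace ℝ (Fin 5)) | q 4 < c} := by
    intro t ht
    have hct : -1 < c - t := hεc t ht.2
    have hct' : c - t < 1 := by linarith [ht.1]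
    have hnn : 0 ≤ 1 - (c - t) ^ 2 := by nlinarith
    constructor
    · have hnorm : ‖f t‖ ^ 2 = 1 := by
        simp only [hf]
        rw [norm_sq_embedL_add_smul, norm_smul, mul_pow, Real.norm_eq_abs, abs_div, abs_norm,
          abs_of_nonneg (Real.sqrt_nonneg _), div_pow, Real.sq_sqrt hnn,
          div_mul_cancel₀ _ (pow_ne_zero 2 hx₀pos.ne')]
        ring
      have h1 : ‖f t‖ = 1 := by nlinarith [norm_nonneg (f t)]
      simpa using h1
    · show f t 4 < c
      simp only [hf]
      simp [embedL_apply, ht.1]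
  have htend : Tendsto f (𝓝[>] (0 : ℝ)) (𝓝 p) := by
    rw [← hf0]
    exact (hfcont.tendsto 0).mono_left nhdsWithin_le_nhds
  refine mem_closure_of_tendsto htend ?_
  filter_upwards [Ioo_mem_nhdsGT hε] with t ht using hmem t ht

/-! ### The inverse function theorem in the form used here -/

/-- Inverse function theorem, injective-differential form, for `4`-manifolds modelled on `ℝ⁴`
(the tree's `Literature.Topology.FourManifolds.isLocalDiffeomorphAt_of_mfderiv`; an injective
endomorphism of `ℝ⁴` is an isomorphism). [cite: LeeSmoothManifolds2013, Thm. 4.5] -/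
theorem isLocalDiffeomorphAt_of_injective_mfderiv_four {M : Type*} [TopologicalSpace M]
    [ChartedSpace (EuclideanSpace ℝ (Fin 4)) M] [IsManifold (𝓡 4) ∞ M] {N : Type*}
    [TopologicalSpace N] [ChartedSpace (EuclideanSpace ℝ (Fin 4)) N] [IsManifold (𝓡 4) ∞ N]
    {f : M → N} (hf : ContMDiff (𝓡 4) (𝓡 4) ∞ f) {x : M}
    (hinj : Injective (mfderiv (𝓡 4) (𝓡 4) f x)) : IsLocalDiffeomorphAt (𝓡 4) (𝓡 4) ∞ f x := by
  obtain ⟨D, hD⟩ : ∃ D : (EuclideanSpace ℝ (Fin 4)) →L[ℝ] (EuclideanSpace ℝ (Fin 4)), mfderiv (𝓡 4) (𝓡 4) f x = D := ⟨_, rfl⟩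
  have hinj' : Injective D := hD ▸ hinj
  set L : (EuclideanSpace ℝ (Fin 4)) ≃ₗ[ℝ] (EuclideanSpace ℝ (Fin 4)) := LinearMap.linearEquivOfInjective (D : (EuclideanSpace ℝ (Fin 4)) →ₗ[ℝ] (EuclideanSpace ℝ (Fin 4))) hinj' rfl with hL
  refine Literature.Topology.FourManifolds.isLocalDiffeomorphAt_of_mfderiv isOpen_univ (mem_univ x)
    hf.contMDiffOn (by exact_mod_cast le_top) L.toContinuousLinearEquiv ?_
  rw [hD]
  ext v
  rfl

/-! ### Graph straightening: the comparison map (definition) -/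

/-- The STRAIGHTENING map `M → ℝ⁵`: `ι` on and below the plane `h = 1 - δ`, and the polar lift of
the shadow (the point of the upper hemisphere with the same shadow) strictly above it. -/
def straighten {M : Type} (ι : M → EuclideanSpace ℝ (Fin 5)) (δ : ℝ) (m : M) :
    EuclideanSpace ℝ (Fin 5) :=
  if 1 - δ < ι m 4 then polarLift (proj5 (ι m)) else ι m

section Straighten

variable {M : Type} {ι : M → EuclideanSpace ℝ (Fin 5)} {δ : ℝ}

/-- Straightening does not change the shadow. -/
theorem proj5_straighten (m : M) : proj5 (straighten ι δ m) = proj5 (ι m) := by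
  unfold straighten
  split_ifs <;> simp

/-- Straightening does not change the shadow (function form). -/
theorem proj5_comp_straighten : proj5 ∘ straighten ι δ = proj5 ∘ ι :=
  funext proj5_straighten

/-- On and below the plane, straightening is `ι`. -/
theorem straighten_of_le {m : M} (hm : ι m 4 ≤ 1 - δ) : straighten ι δ m = ι m := by
  simp [straighten, not_lt.2 hm]

/-- Strictly above the plane, straightening is the polar lift of the shadow. -/
theorem straighten_of_lt {m : M} (hm : 1 - δ < ι m 4) :
    straighten ι δ m = polarLift (proj5 (ι m)) := by
  simp [straighten, hm]

end Straighten

end Summit.SmoothPoincare4.SmoothPoincare4.Theorems.OrigamiFoldExistence.ShadowPleats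

end
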